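import Summits.ABC.StewartYu.PadicW80Par3
import Summits.ABC.StewartYu.PadicW80ParLC
import HarnessLib

/-!
# The `q = 3` (`p = 2`) parameter record — part A: `S₀`, the unit `𝔘 = U/3ᵐ`, the fine unit `𝔔`, `E(c)`

Support file (theorems only; no named facts), cell `abc-stewartyu` (p1; crux `W80Two` stmt-ABC-19486; design memo
HOME/p1/S2-q3-record-design.md).  Base-`3` twin of the record lemmas of `PadicW80ParLA` (§`S₀`) and
`PadicW80ParLB` (the unit) for the derived parameters of `PadicW80Par3.lean`: `S₀3` is a positive multiple of
`3` with `2 c_S m nW⋆ ≤ S₀ ≤ 3 c_S m nW⋆` (`kpts3 J k = 2·3^{k+J}·(S₀/3)`); `U = 3ᵐ 𝔘`;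
`𝔘 ≥ 2^{48m} nG (∏nV) nV_θ W⋆ ≥ 2⁹⁶ · {W⋆, G, m, (∏nV)nV_θ}`, `2⁸⁸(∑V + V_θ) ≤ 𝔘`; the fine unit
`𝔔 = exp(𝔘/1024)` (`𝔔¹⁶ = 𝔅`) and the height unit `E(c)`. Everything is [folklore] bookkeeping on
[cite: Waldschmidt1980, §3.2 (3.2)–(3.14) (pp. 264–265)] and [cite: Yu1989, §3].
-/

noncomputable section

open Finset Real

namespace Summit.ABC.StewartYu

open PadicW80Par (cTp cSp cLp cLp' Ap mRp)

namespace PadicW80ParL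

variable {d : ℕ} (P : PadicW80ParL d)

/-! ### `S₀` -/

/-- `3 ∣ S₀`. [folklore] -/
theorem three_dvd_S₀3 : 3 ∣ P.S₀3 := ⟨⌊cSp * mRp d * P.nWstarℓ⌋₊, by unfold S₀3; ring⟩

/-- `S₀/3 = ⌊c_S m nW⋆⌋`. [folklore] -/
theorem S₀3_div_three : P.S₀3 / 3 = ⌊cSp * mRp d * P.nWstarℓ⌋₊ := by
  unfold S₀3; omega

/-- `S₀ = 3 · (S₀/3)`. [folklore] -/
theorem S₀3_eq_three_mul : P.S₀3 = 3 * (P.S₀3 / 3) := by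
  rw [P.S₀3_div_three]; rfl

/-- `S₀ ≤ 3 c_S m nW⋆`. [folklore] -/
theorem S₀3_le : (P.S₀3 : ℝ) ≤ 3 * (cSp * mRp d * P.nWstarℓ) := by
  unfold S₀3
  push_cast
  have := Nat.floor_le (show 0 ≤ cSp * mRp d * P.nWstarℓ by have := P.cS_mul_ge; linarith)
  linarith

/-- `2 c_S m nW⋆ ≤ S₀` (indeed `S₀ ≥ 3 c_S m nW⋆ − 3` and `c_S m nW⋆ ≥ 2¹⁴`). [folklore] -/
theorem S₀3_ge : 2 * (cSp * mRp d * P.nWstarℓ) ≤ P.S₀3 := by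
  unfold S₀3
  push_cast
  have h1 := Nat.lt_floor_add_one (cSp * mRp d * P.nWstarℓ)
  have h2 := P.cS_mul_ge
  nlinarith

/-- `2¹⁴ ≤ S₀/3` (real). [folklore] -/
theorem S₀3_div_three_ge : (2 : ℝ) ^ 14 - 1 ≤ ((P.S₀3 / 3 : ℕ) : ℝ) := by
  rw [P.S₀3_div_three]
  have h1 := Nat.lt_floor_add_one (cSp * mRp d * P.nWstarℓ)
  have h2 := P.cS_mul_ge
  linarith

/-- `c_S m nW⋆ − 1 ≤ S₀/3 ≤ c_S m nW⋆` (real). [folklore] -/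
theorem S₀3_div_three_bounds :
    cSp * mRp d * P.nWstarℓ - 1 ≤ ((P.S₀3 / 3 : ℕ) : ℝ) ∧ ((P.S₀3 / 3 : ℕ) : ℝ) ≤ cSp * mRp d * P.nWstarℓ := by
  rw [P.S₀3_div_three]
  have h1 := Nat.lt_floor_add_one (cSp * mRp d * P.nWstarℓ)
  have h0 : 0 ≤ cSp * mRp d * P.nWstarℓ := by have := P.cS_mul_ge; linarith
  exact ⟨by linarith, Nat.floor_le h0⟩

/-- `6 ≤ S₀`. [folklore] -/
theorem six_le_S₀3 : 6 ≤ P.S₀3 := by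
  have h := P.S₀3_ge
  have h2 := P.cS_mul_ge
  have : (6 : ℝ) ≤ P.S₀3 := by linarith
  exact_mod_cast this

/-- `0 < S₀` (real). [folklore] -/
theorem S₀3_pos : (0 : ℝ) < P.S₀3 := by have := P.six_le_S₀3; exact_mod_cast (by omega : 0 < P.S₀3)

/-- `#{s < 3^{k+J} S₀ : 3 ∤ s}` in closed form: `kpts3 J k = 2 · 3^{k+J} · (S₀/3)`, so
`3 · kpts3 J k = 2 · 3^{k+J} · S₀`. [folklore] -/
theorem three_mul_kpts3 (J k : ℕ) : 3 * P.kpts3 J k = 2 * 3 ^ (k + J) * P.S₀3 := by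
  unfold kpts3
  have h := P.S₀3_eq_three_mul
  rw [h, Nat.mul_div_cancel_left _ (by norm_num : 0 < 3)]
  ring

/-! ### The unit `𝔘 = U/3ᵐ` -/

/-- `U = 3ᵐ 𝔘`. [folklore] -/
theorem U_eq3 : P.Uℓ = 3 ^ (d + 1) * P.𝔘3 := by
  unfold 𝔘3; field_simp

/-- **The size of the unit `U/3ᵐ`**: `𝔘 ≥ 2^{48m} · nG · (∏ nVⱼ) nV_θ · W⋆` (`A = 2⁵⁰ ≥ 3·2⁴⁸`,
`m^{2m+1}/m! ≥ 1`, `Mcl ≥ 1`). [folklore] -/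
theorem 𝔘3_ge : (2 : ℝ) ^ (48 * (d + 1)) * P.nGℓ * ((∏ j, P.nV j) * P.nVθ) * P.Wstarℓ ≤ P.𝔘3 := by
  unfold 𝔘3 Uℓ PadicW80Par.Ap
  rw [le_div_iff₀ (by positivity)]
  have hfac : (1 : ℝ) ≤ mRp d ^ (2 * d + 3) / (d + 1).factorial := by
    rw [le_div_iff₀ (by positivity), one_mul]
    have h1 : ((d + 1).factorial : ℝ) ≤ ((d + 1 : ℕ) : ℝ) ^ (d + 1) := by
      exact_mod_cast Nat.factorial_le_pow (d + 1)
    have h2 : ((d + 1 : ℕ) : ℝ) ^ (d + 1) ≤ mRp d ^ (2 * d + 3) := by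
      have hm : ((d + 1 : ℕ) : ℝ) = mRp d := by unfold PadicW80Par.mRp; push_cast; ring
      rw [hm]
      exact pow_le_pow_right₀ (by linarith [(two_le_mR P)]) (by omega)
    exact h1.trans h2
  have hW := P.one_le_Wstar; have hG := P.nG_pos; have hVθ := P.one_le_nVθ
  have hV : 1 ≤ ∏ j, P.nV j := P.one_le_prodnV
  have hVV : 0 ≤ (∏ j, P.nV j) * P.nVθ := by positivity
  have hpow : (2 : ℝ) ^ (48 * (d + 1)) * 3 ^ (d + 1) ≤ (2 ^ 50) ^ (d + 1) := by
    rw [show (2 : ℝ) ^ (48 * (d + 1)) = (2 ^ 48) ^ (d + 1) by rw [← pow_mul], ← mul_pow]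
    exact pow_le_pow_left₀ (by positivity) (by norm_num) _
  have hM := P.hMcl
  calc (2 : ℝ) ^ (48 * (d + 1)) * P.nGℓ * ((∏ j, P.nV j) * P.nVθ) * P.Wstarℓ * 3 ^ (d + 1)
      = 1 * (2 ^ (48 * (d + 1)) * 3 ^ (d + 1)) * 1 * ((∏ j, P.nV j) * P.nVθ) * P.Wstarℓ * P.nGℓ := by ring
    _ ≤ P.Mcl * (2 ^ 50) ^ (d + 1) * (mRp d ^ (2 * d + 3) / (d + 1).factorial) * ((∏ j, P.nV j) * P.nVθ) *
          P.Wstarℓ * P.nGℓ := by gcongr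

/-- `𝔘 ≥ 2^{48m} W⋆` (weak form). [folklore] -/
theorem 𝔘3_ge_Wstar : (2 : ℝ) ^ (48 * (d + 1)) * P.Wstarℓ ≤ P.𝔘3 := by
  have h := P.𝔘3_ge
  have hG : 1 ≤ P.nGℓ := P.one_le_nG
  have hV : 1 ≤ (∏ j, P.nV j) * P.nVθ := P.one_le_prodnVVθ
  have hW := P.one_le_Wstar
  calc (2 : ℝ) ^ (48 * (d + 1)) * P.Wstarℓ = 2 ^ (48 * (d + 1)) * 1 * 1 * P.Wstarℓ := by ring
    _ ≤ 2 ^ (48 * (d + 1)) * P.nGℓ * ((∏ j, P.nV j) * P.nVθ) * P.Wstarℓ := by gcongr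
    _ ≤ P.𝔘3 := h

/-- **`2⁹⁶ W⋆ ≤ 𝔘`** (`m ≥ 2`). [folklore] -/
theorem Wstar_le_𝔘3 : (2 : ℝ) ^ 96 * P.Wstarℓ ≤ P.𝔘3 := by
  have h := P.𝔘3_ge_Wstar
  have hW := P.one_le_Wstar
  have hd : 96 ≤ 48 * (d + 1) := by have := P.hd; omega
  calc (2 : ℝ) ^ 96 * P.Wstarℓ ≤ 2 ^ (48 * (d + 1)) * P.Wstarℓ := by gcongr; norm_num
    _ ≤ P.𝔘3 := h

/-- `2⁹⁶ G ≤ 𝔘` (uses the floor `ℓ ≤ W⋆`). [folklore] -/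
theorem G_le_𝔘3 : (2 : ℝ) ^ 96 * P.Gℓ ≤ P.𝔘3 := by
  have h := P.𝔘3_ge
  have hG := P.one_le_G; have hV := P.one_le_prodnVVθ; have hW := P.one_le_Wstar
  have hGW := P.G_le_nG_mul_Wstar; have hnG := P.one_le_nG
  have hd : 96 ≤ 48 * (d + 1) := by have := P.hd; omega
  calc (2 : ℝ) ^ 96 * P.Gℓ ≤ 2 ^ (48 * (d + 1)) * P.Gℓ := by gcongr; norm_num
    _ ≤ 2 ^ (48 * (d + 1)) * (P.nGℓ * P.Wstarℓ) := by gcongr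
    _ = 2 ^ (48 * (d + 1)) * P.nGℓ * 1 * P.Wstarℓ := by ring
    _ ≤ 2 ^ (48 * (d + 1)) * P.nGℓ * ((∏ j, P.nV j) * P.nVθ) * P.Wstarℓ := by
        have : (0 : ℝ) ≤ 2 ^ (48 * (d + 1)) * P.nGℓ := by positivity
        gcongr
    _ ≤ P.𝔘3 := h

/-- The normalised sizes are lower-order: `2⁹⁶ (∏nVⱼ) nV_θ ≤ 𝔘`. [folklore] -/
theorem prodnV_le_𝔘3 : (2 : ℝ) ^ 96 * ((∏ j, P.nV j) * P.nVθ) ≤ P.𝔘3 := by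
  have h := P.𝔘3_ge
  have hG := P.one_le_nG; have hV := P.one_le_prodnVVθ; have hW := P.one_le_Wstar
  have hd : 96 ≤ 48 * (d + 1) := by have := P.hd; omega
  have h0 : 0 ≤ (∏ j, P.nV j) * P.nVθ := by positivity
  calc (2 : ℝ) ^ 96 * ((∏ j, P.nV j) * P.nVθ) ≤ 2 ^ (48 * (d + 1)) * ((∏ j, P.nV j) * P.nVθ) := by
        gcongr; norm_num
    _ = 2 ^ (48 * (d + 1)) * 1 * ((∏ j, P.nV j) * P.nVθ) * 1 := by ring
    _ ≤ 2 ^ (48 * (d + 1)) * P.nGℓ * ((∏ j, P.nV j) * P.nVθ) * P.Wstarℓ := by gcongr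
    _ ≤ P.𝔘3 := h

/-- `2⁹⁶ m ≤ 𝔘` (`9m ≤ W⋆`). [folklore] -/
theorem mR_le_𝔘3 : (2 : ℝ) ^ 96 * mRp d ≤ P.𝔘3 := by
  have h1 := P.nine_mR_le_Wstar; have h2 := P.Wstar_le_𝔘3; have := mR_pos P
  nlinarith

/-- `∑Vⱼ + V_θ ≤ 2⁻⁸⁸ 𝔘` (`∑V + V_θ = ℓ(∑nV + nV_θ) ≤ ℓ m (∏nV)nV_θ`, `ℓ ≤ W⋆`, `2⁸⁸ m ≤ 2^{48m}`). [folklore] -/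
theorem sumV_le_𝔘3 : (2 : ℝ) ^ 88 * ((∑ j, P.V j) + P.Vθ) ≤ P.𝔘3 := by
  have h1 := P.sumnV_le
  have hm := mR_pos P
  have h0 : 0 ≤ (∏ j, P.nV j) * P.nVθ := le_trans zero_le_one P.one_le_prodnVVθ
  have h := P.𝔘3_ge
  have hG := P.one_le_nG; have hW := P.ℓ_le_Wstar; have hℓ := P.ℓ_pos
  have hpow : (2 : ℝ) ^ 88 * mRp d ≤ 2 ^ (48 * (d + 1)) := by
    have hm2 : mRp d ≤ 2 ^ (d + 1) := by
      unfold mRp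
      have : ((d : ℝ) + 1) = ((d + 1 : ℕ) : ℝ) := by push_cast; ring
      rw [this]; exact_mod_cast (Nat.lt_two_pow_self).le
    have hd := P.hd
    calc (2 : ℝ) ^ 88 * mRp d ≤ 2 ^ 88 * 2 ^ (d + 1) := by gcongr
      _ = 2 ^ (89 + d) := by rw [← pow_add]; ring_nf
      _ ≤ 2 ^ (48 * (d + 1)) := pow_le_pow_right₀ (by norm_num) (by omega)
  rw [P.sumV_eq]
  calc (2 : ℝ) ^ 88 * (P.ℓ * ((∑ j, P.nV j) + P.nVθ)) ≤ 2 ^ 88 * (P.ℓ * ((mRp d) * ((∏ j, P.nV j) * P.nVθ))) := by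
        gcongr
    _ = (2 ^ 88 * mRp d) * ((∏ j, P.nV j) * P.nVθ) * P.ℓ := by ring
    _ ≤ 2 ^ (48 * (d + 1)) * ((∏ j, P.nV j) * P.nVθ) * P.ℓ := by gcongr
    _ = 2 ^ (48 * (d + 1)) * 1 * ((∏ j, P.nV j) * P.nVθ) * P.ℓ := by ring
    _ ≤ 2 ^ (48 * (d + 1)) * P.nGℓ * ((∏ j, P.nV j) * P.nVθ) * P.Wstarℓ := by
        have h48 : (0 : ℝ) ≤ 2 ^ (48 * (d + 1)) := pow_nonneg zero_le_two _
        have hG0 : (0 : ℝ) ≤ P.nGℓ := le_trans zero_le_one hG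
        have step : (2 : ℝ) ^ (48 * (d + 1)) * 1 * ((∏ j, P.nV j) * P.nVθ) ≤
            2 ^ (48 * (d + 1)) * P.nGℓ * ((∏ j, P.nV j) * P.nVθ) :=
          mul_le_mul_of_nonneg_right (mul_le_mul_of_nonneg_left hG h48) h0
        exact mul_le_mul step hW hℓ.le (mul_nonneg (mul_nonneg h48 hG0) h0)
    _ ≤ P.𝔘3 := h

/-- `2⁹⁶ ≤ 𝔘`. [folklore] -/
theorem 𝔘3_ge' : (2 : ℝ) ^ 96 ≤ P.𝔘3 := by
  have := P.Wstar_le_𝔘3; have := P.one_le_Wstar; nlinarith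

/-- `0 < 𝔘`. [folklore] -/
theorem 𝔘3_pos : 0 < P.𝔘3 := lt_of_lt_of_le (by norm_num) P.𝔘3_ge'

/-- `1 ≤ 𝔅`. [folklore] -/
theorem one_le_𝔅3 : 1 ≤ P.𝔅3 := Real.one_le_exp (div_nonneg P.𝔘3_pos.le (by norm_num))

/-- `0 < 𝔅`. [folklore] -/
theorem 𝔅3_pos : 0 < P.𝔅3 := Real.exp_pos _

/-- `0 < 𝔔`. [folklore] -/
theorem 𝔔3_pos : 0 < P.𝔔3 := Real.exp_pos _

/-- `1 ≤ 𝔔`. [folklore] -/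
theorem one_le_𝔔3 : 1 ≤ P.𝔔3 := Real.one_le_exp (div_nonneg P.𝔘3_pos.le (by norm_num))

/-- `𝔔ⁿ = exp(n·𝔘/1024)`. [folklore] -/
theorem 𝔔3_pow_eq (n : ℕ) : P.𝔔3 ^ n = Real.exp (n * (P.𝔘3 / 1024)) := by
  unfold 𝔔3; rw [← Real.exp_nat_mul]

/-- `log 𝔔ⁿ = n·𝔘/1024`. [folklore] -/
theorem log_𝔔3_pow (n : ℕ) : Real.log (P.𝔔3 ^ n) = n * (P.𝔘3 / 1024) := by
  rw [P.𝔔3_pow_eq, Real.log_exp]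

/-- `𝔔¹⁶ = 𝔅`. [folklore] -/
theorem 𝔔3_pow_sixteen : P.𝔔3 ^ 16 = P.𝔅3 := by
  rw [P.𝔔3_pow_eq]; unfold 𝔅3; congr 1; push_cast; ring

/-- `1 ≤ 𝔔ⁿ`. [folklore] -/
theorem one_le_𝔔3_pow (n : ℕ) : 1 ≤ P.𝔔3 ^ n := one_le_pow₀ P.one_le_𝔔3

/-- `exp y ≤ 𝔔ⁿ` when `y ≤ n·𝔘/1024`. [folklore] -/
theorem exp_le_𝔔3_pow {y : ℝ} {n : ℕ} (hy : y ≤ n * (P.𝔘3 / 1024)) : Real.exp y ≤ P.𝔔3 ^ n := by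
  rw [P.𝔔3_pow_eq]; exact Real.exp_le_exp.mpr hy

/-- `exp y ≤ 𝔔` when `y ≤ 𝔘/1024`. [folklore] -/
theorem exp_le_𝔔3 {y : ℝ} (hy : y ≤ P.𝔘3 / 1024) : Real.exp y ≤ P.𝔔3 := Real.exp_le_exp.mpr hy

/-- `y ≤ 𝔔ⁿ` when `log y ≤ n·𝔘/1024`. [folklore] -/
theorem le_𝔔3_pow_of_log_le {y : ℝ} {n : ℕ} (hy : Real.log y ≤ n * (P.𝔘3 / 1024)) : y ≤ P.𝔔3 ^ n := by
  rcases le_or_gt y 0 with h | h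
  · exact h.trans (pow_pos P.𝔔3_pos n).le
  · rw [← Real.exp_log h]; exact P.exp_le_𝔔3_pow hy

/-- `y ≤ 𝔔` when `log y ≤ 𝔘/1024`. [folklore] -/
theorem le_𝔔3_of_log_le {y : ℝ} (hy : Real.log y ≤ P.𝔘3 / 1024) : y ≤ P.𝔔3 := by
  have := P.le_𝔔3_pow_of_log_le (n := 1) (by simpa using hy)
  simpa using this

/-- Products of quantities `≤ 𝔔ⁱ`. [folklore] -/
theorem mul_le_𝔔3_pow {a b : ℝ} {i j : ℕ} (ha : a ≤ P.𝔔3 ^ i) (hb : b ≤ P.𝔔3 ^ j) (hb0 : 0 ≤ b) :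
    a * b ≤ P.𝔔3 ^ (i + j) := by
  rw [pow_add]
  have h𝔔 := P.𝔔3_pos
  calc a * b ≤ P.𝔔3 ^ i * b := mul_le_mul_of_nonneg_right ha hb0
    _ ≤ P.𝔔3 ^ i * P.𝔔3 ^ j := mul_le_mul_of_nonneg_left hb (by positivity)

/-- `0 < E(c)`. [folklore] -/
theorem Efac3_pos (c : ℝ) : 0 < P.Efac3 c := Real.exp_pos _

/-- `1 ≤ E(c)` for `c ≥ 0`. [folklore] -/
theorem one_le_Efac3 {c : ℝ} (hc : 0 ≤ c) : 1 ≤ P.Efac3 c := by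
  unfold Efac3; exact Real.one_le_exp (by have := P.𝔘3_pos; unfold cLp'; positivity)

/-- `log E(c) = c·𝔘/(3c_L')`. [folklore] -/
theorem log_Efac3 (c : ℝ) : Real.log (P.Efac3 c) = c * (P.𝔘3 / (3 * cLp')) := by
  unfold Efac3; rw [Real.log_exp]

/-- `E` is monotone. [folklore] -/
theorem Efac3_mono {c c' : ℝ} (h : c ≤ c') : P.Efac3 c ≤ P.Efac3 c' := by
  unfold Efac3
  exact Real.exp_le_exp.mpr (mul_le_mul_of_nonneg_right h (by have := P.𝔘3_pos; unfold cLp'; positivity))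

end PadicW80ParL

end Summit.ABC.StewartYu

end
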